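import Summits.CriticalPhenomena.Ising3DConformalLimit.Theses.PrecisionLaplacian
import Summits.CriticalPhenomena.Ising3DConformalLimit.Theses.BernsteinTemperature
import Summits.CriticalPhenomena.Ising3DConformalLimit.Theses.WeylWindow
import Summits.CriticalPhenomena.Ising3DConformalLimit.Theses.IsingEuclidUpgrade
import Summits.CriticalPhenomena.Ising3DConformalLimit.Theses.HyperoctahedralRP
import Summits.CriticalPhenomena.Ising3DConformalLimit.Theses.PerfectScreening
import Summits.CriticalPhenomena.Ising3DConformalLimit.Theses.GaussianScaleMixture
import Summits.CriticalPhenomena.Ising3DConformalLimit.Theorems.HyperoctahedralRPHRP2Rigidity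
import Summits.CriticalPhenomena.Ising3DConformalLimit.Theorems.PrecisionLaplacianMoebiusLimitOfTwoPointLawTwoShellGlue
import Summits.CriticalPhenomena.Ising3DConformalLimit.Theorems.MoebiusLimitExists.Negative.FreeTranslations
import Literature.Probability.LatticeModels.CriticalTwoPointLawDimension
import HarnessLib

/-!
# Crux `MoebiusLimitOfTwoPointLaw` (item stmt-CriticalPhenomena-4801) from BARE existence and the two covariance upgrades
# (line `multipole-ward-nonsat-endpoint`, lead c2; `--supports stmt-CriticalPhenomena-4801`)

The crux is `IsingEuclidUpgradeR2RotInvPowerLaw (item 0634) → MoebiusLimitExists (item 1344)`. Here the crux's OWN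
hypothesis, the two-point power law, is put to work on the existence side: under item 0634 the scale covariance and the
`Δ > 0` inside item stmt-CriticalPhenomena-1981 `HyperoctahedralRP.ExistsScaleCovariantLimit` are automatic for ANY
non-degenerate pointwise limit (`isScaleCovariant_of_limit`, p89802, with the SAME `Δ` as in the two-point law;
`twoPointLaw_exponent_pos`), and so are normalisation and translation invariance (truncation off `NonCoincident`;
`MoebiusLimitExistsNegative.limit_translate`). Hence

* `existsScaleCovariantLimit_of_limitExists` : 0634 → 4738 → 1981 (bare existence `WeylWindow.LimitExists`, item
  stmt-CriticalPhenomena-4738, is enough), and `existsScaleCovariantLimit_iff_limitExists` : 0634 → (1981 ↔ 4738);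
* `moebiusLimitOfTwoPointLaw_of_bare` : 4738 → 1980 → 1982 → crux (items `HyperoctahedralRP.LimitRotationInvariant`,
  `HyperoctahedralRP.InversionUpgradeNormalised`; `HRP2Rigidity`, item 1979, is the tree theorem `HRP2Rigidity_of`);
* `limitRotationInvariant_of_rotationUpgradeFromTwoPoint` : 0634 → 8367 → 1980 — the two-point law also discharges the
  two-point isotropy hypothesis of item stmt-CriticalPhenomena-8367 `GaussianScaleMixture.RotationUpgradeFromTwoPoint`
  (`twoPoint_of_limit`: every non-degenerate limit has the round two-point function `c'‖a−b‖^{-2Δ}`), so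
  `moebiusLimitOfTwoPointLaw_of_bare₂` : 4738 → 8367 → 1982 → crux.

The converse edges (crux ⇒ each factor, hence `crux ↔ (0634 → 4738 ∧ 8367 ∧ 1982)`) are composed in the companion file
`…BareFactorisation.lean` with the landed `MoebiusLimitExistsOnlyInteraction.MoebiusLimitExists_iff_hrp` (p114842).

References: H. Duminil-Copin, ICM 2022, §8.1 p. 25, §8.4 p. 29 (existence / rotations / conformal invariance open on
`ℤ³`); Di Francesco–Mathieu–Sénéchal 1997 §4.3.1 (Möbius = Euclid + dilations + inversion). No definitions, no `sorry`.
-/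

noncomputable section

namespace Summit.CriticalPhenomena.Ising3DConformalLimit.PrecisionLaplacianMoebiusLimitOfTwoPointLaw

open Literature.Probability.LatticeModels Filter Topology
open Summit.CriticalPhenomena.Ising3DConformalLimit.Theses
open Summit.CriticalPhenomena.Ising3DConformalLimit.MoebiusLimitExistsNegative
  (limit_translate add_mem_nonCoincident_iff isTranslationInvariant_normalised_of_limit)

open Classical in
/-- **Under the two-point law, bare existence gives item 1981.** If `⟨σ₀σ_x⟩_{β_c}‖x‖^{2Δ} → c > 0` (item 0634)
and the critical correlators have SOME non-degenerate pointwise scaling limit `(ρ, S)` (item 4738), then the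
truncation of `S` off `NonCoincident` is a normalised, non-degenerate, translation-invariant limit which is scale
covariant with the two-point dimension `Δ > 0` — item stmt-CriticalPhenomena-1981
`HyperoctahedralRP.ExistsScaleCovariantLimit`. (Scale covariance: `isScaleCovariant_of_limit`; translations:
`limit_translate`; `Δ ≥ 1/2 > 0`: `twoPointLaw_exponent_pos`.) [cite: DuminilCopinICM2022, §8.1 p. 25] -/
theorem existsScaleCovariantLimit_of_limitExists
    (hP : IsingEuclidUpgrade.IsingEuclidUpgradeR2RotInvPowerLaw) (hL : WeylWindow.LimitExists) :
    HyperoctahedralRP.ExistsScaleCovariantLimit := by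
  obtain ⟨Δ, c, hc, hPt⟩ := hP
  obtain ⟨ρ, S, hρ, hlim, hnd⟩ := hL
  set S' : CorrFamily 3 := fun n x => if x ∈ NonCoincident 3 n then S n x else 0 with hS'
  have hlim' : HasPointwiseScalingLimit (criticalCorr 3) ρ S' :=
    fun n => (hlim n).congr_right fun x hx => by simp only [hS', if_pos hx]
  have hnorm' : ∀ n z, z ∉ NonCoincident 3 n → S' n z = 0 := fun n z hz => by
    simp only [hS', if_neg hz]
  have hnd' : IsNondegenerateTwoPoint S' := fun x hx => by
    simp only [hS', if_pos hx]
    exact hnd x hx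
  have htr' : IsTranslationInvariant S' := isTranslationInvariant_normalised_of_limit hlim
  have hsc' : IsScaleCovariant Δ S' := isScaleCovariant_of_limit hc hPt hρ hlim' hnd' hnorm'
  exact ⟨ρ, Δ, S', hρ, twoPointLaw_exponent_pos hc hPt, hlim', hnorm', hnd', htr', hsc'⟩

/-- Item 1981 gives item 4738 (forget normalisation, translations, dilations). [folklore] -/
theorem limitExists_of_existsScaleCovariantLimit (h : HyperoctahedralRP.ExistsScaleCovariantLimit) :
    WeylWindow.LimitExists := by
  obtain ⟨ρ, _, S, hρ, _, hlim, _, hnd, _, _⟩ := h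
  exact ⟨ρ, S, hρ, hlim, hnd⟩

/-- **Under the two-point law, items 1981 and 4738 are equivalent.** [cite: DuminilCopinICM2022, §8.1 p. 25] -/
theorem existsScaleCovariantLimit_iff_limitExists (hP : IsingEuclidUpgrade.IsingEuclidUpgradeR2RotInvPowerLaw) :
    HyperoctahedralRP.ExistsScaleCovariantLimit ↔ WeylWindow.LimitExists :=
  ⟨limitExists_of_existsScaleCovariantLimit, existsScaleCovariantLimit_of_limitExists hP⟩

/-- **Crux 4801 from bare existence and the two covariance upgrades of route `HyperoctahedralRP`.**
`WeylWindow.LimitExists` (item 4738) → `HyperoctahedralRP.LimitRotationInvariant` (item 1980) →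
`HyperoctahedralRP.InversionUpgradeNormalised` (item 1982) → `PrecisionLaplacian.MoebiusLimitOfTwoPointLaw`: the
two-point law turns 4738 into 1981 (`existsScaleCovariantLimit_of_limitExists`); its witness is `O(3)` invariant by 1980
(`HRP2Rigidity_of` feeds its hypothesis), hence Euclidean invariant, hence inversion covariant by 1982.
[cite: FrancescoMathieuSenechal1997, §4.3.1 eq. (4.62)] -/
theorem moebiusLimitOfTwoPointLaw_of_bare :
    WeylWindow.LimitExists → HyperoctahedralRP.LimitRotationInvariant →
      HyperoctahedralRP.InversionUpgradeNormalised → PrecisionLaplacian.MoebiusLimitOfTwoPointLaw := by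
  intro hL h1980 h1982 hP
  obtain ⟨ρ, Δ, S, hρ, hΔ, hlim, hnorm, hnd, htr, hsc⟩ := existsScaleCovariantLimit_of_limitExists hP hL
  have hrot : IsRotationInvariant S :=
    h1980 _root_.Summit.CriticalPhenomena.Ising3DConformalLimit.Cruxes.HRP2Rigidity.XRayMellin.HRP2Rigidity_of
      ρ Δ S hρ hlim hnorm hnd htr hsc
  have hinv : IsInversionCovariant Δ S := h1982 ρ Δ S hρ hlim hnorm hnd ⟨htr, hrot⟩ hsc
  exact ⟨ρ, Δ, S, hρ, hΔ, hlim, hnd, ⟨htr, hrot⟩, hsc, hinv⟩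

/-- The same for the `BernsteinTemperature` spelling of the crux. [cite: FrancescoMathieuSenechal1997, §4.3.1] -/
theorem moebiusLimitOfTwoPointLaw_of_bare'
    (hL : WeylWindow.LimitExists) (h1980 : HyperoctahedralRP.LimitRotationInvariant)
    (h1982 : HyperoctahedralRP.InversionUpgradeNormalised) :
    BernsteinTemperature.MoebiusLimitOfTwoPointLaw :=
  moebiusLimitOfTwoPointLaw_of_bare hL h1980 h1982

/-! ### The `O(3)` factor is the `n`-point upgrade only (item 8367) -/

/-- **Under the two-point law, item 8367 gives item 1980.** The two-point isotropy hypothesis of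
`GaussianScaleMixture.RotationUpgradeFromTwoPoint` holds for every non-degenerate pointwise limit once
`⟨σ₀σ_x⟩‖x‖^{2Δ} → c > 0` (`twoPoint_of_limit`: `S₂(a,b) = c'‖a − b‖^{-2Δ}`), so 8367 yields the conclusion of
`HyperoctahedralRP.LimitRotationInvariant` for every limit (its hypothesis `HRP2Rigidity` is not even needed).
[cite: DuminilCopinICM2022, §8.1 p. 25] -/
theorem limitRotationInvariant_of_rotationUpgradeFromTwoPoint
    (hP : IsingEuclidUpgrade.IsingEuclidUpgradeR2RotInvPowerLaw)
    (h8367 : GaussianScaleMixture.RotationUpgradeFromTwoPoint) :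
    HyperoctahedralRP.LimitRotationInvariant := by
  intro _ ρ Δ S hρ hlim hnorm hnd htr hsc
  obtain ⟨Δ₀, c, hc, hPt⟩ := hP
  obtain ⟨c', -, h2⟩ := twoPoint_of_limit hc hPt hlim hnd
  refine h8367 ρ Δ S hρ hlim hnorm hnd htr hsc fun R x hx => ?_
  have hRx : R x ≠ 0 := by
    intro h
    apply hx
    have h0 : R x = R 0 := by rw [h, LinearIsometryEquiv.map_zero]
    exact R.injective h0
  rw [h2 0 (R x) (Ne.symm hRx), h2 0 x (Ne.symm hx), zero_sub, zero_sub, norm_neg, norm_neg,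
    LinearIsometryEquiv.norm_map]

/-- **Item 1980 gives item 8367** (unconditionally: `HRP2Rigidity`, item 1979, is the tree theorem
`HRP2Rigidity_of`, and 8367 only adds a hypothesis). [folklore] -/
theorem rotationUpgradeFromTwoPoint_of_limitRotationInvariant
    (h : HyperoctahedralRP.LimitRotationInvariant) : GaussianScaleMixture.RotationUpgradeFromTwoPoint :=
  fun ρ Δ S hρ hlim hnorm hnd htr hsc _ =>
    h _root_.Summit.CriticalPhenomena.Ising3DConformalLimit.Cruxes.HRP2Rigidity.XRayMellin.HRP2Rigidity_of
      ρ Δ S hρ hlim hnorm hnd htr hsc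

/-- **Crux 4801 from bare existence, the `n`-point rotation upgrade and the inversion upgrade**:
items 4738 → 8367 → 1982 → crux. [cite: DuminilCopinICM2022, §8.4 p. 29] -/
theorem moebiusLimitOfTwoPointLaw_of_bare₂
    (hL : WeylWindow.LimitExists) (h8367 : GaussianScaleMixture.RotationUpgradeFromTwoPoint)
    (h1982 : HyperoctahedralRP.InversionUpgradeNormalised) :
    PrecisionLaplacian.MoebiusLimitOfTwoPointLaw :=
  fun hP => moebiusLimitOfTwoPointLaw_of_bare hL
    (limitRotationInvariant_of_rotationUpgradeFromTwoPoint hP h8367) h1982 hP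

/-- The same for the `BernsteinTemperature` spelling. [cite: DuminilCopinICM2022, §8.4 p. 29] -/
theorem moebiusLimitOfTwoPointLaw_of_bare₂'
    (hL : WeylWindow.LimitExists) (h8367 : GaussianScaleMixture.RotationUpgradeFromTwoPoint)
    (h1982 : HyperoctahedralRP.InversionUpgradeNormalised) :
    BernsteinTemperature.MoebiusLimitOfTwoPointLaw :=
  moebiusLimitOfTwoPointLaw_of_bare₂ hL h8367 h1982

end Summit.CriticalPhenomena.Ising3DConformalLimit.PrecisionLaplacianMoebiusLimitOfTwoPointLaw

end
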